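import Summits.AtomisticToContinuum.Crystallization.Theorems.OverbindingBudgetAffineFarFieldCellLedger

/-!
# OverbindingBudget (2c) — part 27V-L(B): the ledger on the IDEAL-CELL templates (lens-4 g96; critic r1701 (β)(ii))

Support file, pure analysis on `ℝ³`, NO atlas.  The template cells of the far-field ledger `farField_ledger` (part
27V-L(A)) are instantiated by the letter's ideal Voronoi cell at nearest-neighbour distance `ν`, homothetically
SHRUNK / GROWN by the symbolic sandwich parameter `s`:  `Kin b = idealCell b (ν(1−s))`, `Kout b = idealCell b
(ν(1+s))` (`b = true`: the `k`-cell `rdCell`, `b = false`: the `h`-cell `trdCell`, parts 27Vb-K), with their exact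
moment data, cubic constants `idealTau` (`0` for `k` by central symmetry, `(14/45)h³` for `h`, part 27Vb-K(C)),
radius `r = ν(1+s)/√2` and volume ratio `((1+s)/(1−s))³ ≤ 1 + θ`; the reference cells are the moved ideal cells
`moveMap 0 q R '' idealCell b ν` at unit density `ρ = √2/ν³`.  Every quantity stays a binder (`ν, s, θ, a, ε`); the
numerals of the desk (s = 1.974e-3, θ = 1.192e-2, a r = 0.7171) appear in part 27Vc only.

* `idealCell`, `idealTau` and their data (`isMomentCell_idealCell`, `cubic_clause_idealCell`, `volume_idealCell`,
  monotonicity, `volume_idealCell_ratio_le`); the moved reference cells (`isLooseMomentCell_refCell`,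
  `cubic_clause_refCell`, `rho_mul_volume_refCell`);
* ★ `farField_ledger_ideal` — 27V-L with the ideal templates: the inequality the 31280 column consumes, all
  constants symbolic.
-/

namespace Summit.AtomisticToContinuum.Crystallization.Theorems.OverbindingBudgetAffineFarFieldCellLedgerIdeal

noncomputable section

open Set Filter MeasureTheory
open scoped Topology
open Summit.AtomisticToContinuum.Crystallization.Theorems.OverbindingBudgetAffineFarFieldTaylor
open Summit.AtomisticToContinuum.Crystallization.Theorems.OverbindingBudgetAffineFarFieldCellTaylor
open Summit.AtomisticToContinuum.Crystallization.Theorems.OverbindingBudgetAffineFarFieldCellSymm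
open Summit.AtomisticToContinuum.Crystallization.Theorems.OverbindingBudgetAffineFarFieldCellMove
open Summit.AtomisticToContinuum.Crystallization.Theorems.OverbindingBudgetAffineFarFieldCellAffine
open Summit.AtomisticToContinuum.Crystallization.Theorems.OverbindingBudgetAffineFarFieldCellLoose
open Summit.AtomisticToContinuum.Crystallization.Theorems.OverbindingBudgetAffineFarFieldCellSandwich
open Summit.AtomisticToContinuum.Crystallization.Theorems.OverbindingBudgetAffineFarFieldCellSum
open Summit.AtomisticToContinuum.Crystallization.Theorems.OverbindingBudgetAffineFarFieldCellLedger
open Summit.AtomisticToContinuum.Crystallization.Theorems.OverbindingBudgetAffineFarFieldCellRD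
open Summit.AtomisticToContinuum.Crystallization.Theorems.OverbindingBudgetAffineFarFieldCellTwist
open Summit.AtomisticToContinuum.Crystallization.Theorems.OverbindingBudgetAffineFarFieldCellTRD
open Summit.AtomisticToContinuum.Crystallization.Theorems.OverbindingBudgetAffineFarFieldCellTRDCubic

local notation "E3" => EuclideanSpace ℝ (Fin 3)

/-! ### The ideal-cell templates -/

/-- The ideal Voronoi cell of letter `b` at nearest-neighbour distance `ν`, about `0`, in the reference frame:
`b = true` ↦ the `k`-cell (rhombic dodecahedron), `b = false` ↦ the `h`-cell (trapezo-rhombic dodecahedron). -/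
def idealCell (b : Bool) (ν : ℝ) : Set E3 :=
  bif b then rdCell (ν / (2 * Real.sqrt 2)) else trdCell (ν / (2 * Real.sqrt 2))

/-- The structured cubic constant of the ideal cell of letter `b`: `0` for `k` (central symmetry), `(14/45)h³` for
`h`. -/
def idealTau (b : Bool) (ν : ℝ) : ℝ :=
  bif b then 0 else 14 / 45 * (ν / (2 * Real.sqrt 2)) ^ 3

/-- The `k`-cells are monotone in their size parameter. -/
theorem rdCell_mono {h h' : ℝ} (hh : h ≤ h') : rdCell h ⊆ rdCell h' := by
  intro x hx i j hij
  exact (hx i j hij).trans (by linarith)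

/-- The `h`-cells are monotone in their size parameter. -/
theorem trdCell_mono {h h' : ℝ} (hh : h ≤ h') : trdCell h ⊆ trdCell h' :=
  Set.preimage_mono (rdCell_mono hh)

/-- The ideal cells are monotone in `ν`. -/
theorem idealCell_mono (b : Bool) {ν ν' : ℝ} (hν : ν ≤ ν') : idealCell b ν ⊆ idealCell b ν' := by
  have hs2 : 0 < Real.sqrt 2 := by positivity
  have h : ν / (2 * Real.sqrt 2) ≤ ν' / (2 * Real.sqrt 2) := div_le_div_of_nonneg_right hν (by positivity)
  cases b
  · exact trdCell_mono h
  · exact rdCell_mono h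

/-- The ideal cells are compact. -/
theorem isCompact_idealCell (b : Bool) {ν : ℝ} (hν : 0 ≤ ν) : IsCompact (idealCell b ν) := by
  have hh : 0 ≤ ν / (2 * Real.sqrt 2) := by positivity
  cases b
  · exact isCompact_trdCell hh
  · exact isCompact_rdCell hh

/-- The ideal cells lie in the closed ball of radius `ν/√2`. -/
theorem idealCell_subset_closedBall (b : Bool) {ν : ℝ} (hν : 0 ≤ ν) :
    idealCell b ν ⊆ Metric.closedBall 0 (ν / Real.sqrt 2) := by
  cases b
  · exact trdCell_nu_subset_closedBall hν
  · exact rdCell_nu_subset_closedBall hν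

/-- Volume of the ideal cells: `ν³/√2`. -/
theorem volume_idealCell (hC : HasRadialMoments (rdCell 1) 16 24 (656 / 15)) (b : Bool) {ν : ℝ} (hν : 0 < ν) :
    (volume (idealCell b ν)).toReal = ν ^ 3 / Real.sqrt 2 := by
  cases b
  · exact volume_trdCell_nu hC hν
  · exact volume_rdCell_nu hC hν

/-- The ideal cells are exact moment cells about `0` with the common data of parts 27Vb-K(A)/(B). -/
theorem isMomentCell_idealCell (hC : HasRadialMoments (rdCell 1) 16 24 (656 / 15)) (b : Bool) {ν : ℝ}
    (hν : 0 < ν) :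
    IsMomentCell (idealCell b ν) 0 (ν ^ 2 / 16) 0 (3 * (ν / (2 * Real.sqrt 2)) ^ 3) (41 / 960 * ν ^ 4) := by
  cases b
  · exact isMomentCell_trdCell_nu hC hν
  · exact isMomentCell_rdCell_nu hC hν

/-- The cubic constants are non-negative. -/
theorem idealTau_nonneg (b : Bool) {ν : ℝ} (hν : 0 ≤ ν) : 0 ≤ idealTau b ν := by
  cases b
  · change 0 ≤ 14 / 45 * (ν / (2 * Real.sqrt 2)) ^ 3; positivity
  · exact le_rfl

/-- The structured cubic clause of the ideal cells (`k`: central symmetry; `h`: part 27Vb-K(C) under the leaf `hT`). -/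
theorem cubic_clause_idealCell (hC : HasRadialMoments (rdCell 1) 16 24 (656 / 15))
    (hT : |∫ x in trdCell 1, x 0 * x 1 * x 2| ≤ 112 / 405) (b : Bool) {ν : ℝ} (hν : 0 < ν)
    (B : E3 [×3]→L[ℝ] ℝ) :
    |∫ x in idealCell b ν, B (fun _ => x - 0)| ≤ idealTau b ν * (volume (idealCell b ν)).toReal * ‖B‖ := by
  cases b
  · exact cubic_clause_trdCell_nu hC hT hν B
  · exact cubic_clause_of_centrallySymmetric (isCentrallySymmetric_rdCell _) B

/-- The volume ratio of the grown to the shrunk template: `|idealCell b (ν(1+s))| ≤ (1+θ)|idealCell b (ν(1−s))|` as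
soon as `(1+s)³ ≤ (1+θ)(1−s)³`. -/
theorem volume_idealCell_ratio_le (hC : HasRadialMoments (rdCell 1) 16 24 (656 / 15)) (b : Bool) {ν s θ : ℝ}
    (hν : 0 < ν) (hs0 : 0 ≤ s) (hs1 : s < 1) (hθ : (1 + s) ^ 3 ≤ (1 + θ) * (1 - s) ^ 3) :
    (volume (idealCell b (ν * (1 + s)))).toReal ≤ (1 + θ) * (volume (idealCell b (ν * (1 - s)))).toReal := by
  rw [volume_idealCell hC b (by nlinarith), volume_idealCell hC b (by nlinarith)]
  have hs2 : 0 < Real.sqrt 2 := by positivity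
  rw [mul_pow, mul_pow, mul_div_assoc, mul_div_assoc, ← mul_assoc, mul_comm (1 + θ), mul_assoc]
  exact mul_le_mul_of_nonneg_left (by rw [← mul_div_assoc]; exact div_le_div_of_nonneg_right hθ hs2.le)
    (by positivity)

/-! ### The moved reference cells at unit density -/

/-- A moved ideal cell is a loose moment cell about its site with exact centroid. -/
theorem isLooseMomentCell_refCell (hC : HasRadialMoments (rdCell 1) 16 24 (656 / 15)) (b : Bool) {ν : ℝ}
    (hν : 0 < ν) (q : E3) (R : E3 ≃ₗᵢ[ℝ] E3) :
    IsLooseMomentCell (moveMap 0 q R '' idealCell b ν) q 0 (ν ^ 2 / 16) 0 (3 * (ν / (2 * Real.sqrt 2)) ^ 3)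
      (41 / 960 * ν ^ 4) :=
  IsMomentCell.loose (IsMomentCell.image_moveMap (isMomentCell_idealCell hC b hν) q R)

/-- The structured cubic clause of a moved ideal cell. -/
theorem cubic_clause_refCell (hC : HasRadialMoments (rdCell 1) 16 24 (656 / 15))
    (hT : |∫ x in trdCell 1, x 0 * x 1 * x 2| ≤ 112 / 405) (b : Bool) {ν : ℝ} (hν : 0 < ν) (q : E3)
    (R : E3 ≃ₗᵢ[ℝ] E3) (B : E3 [×3]→L[ℝ] ℝ) :
    |∫ x in moveMap 0 q R '' idealCell b ν, B (fun _ => x - q)|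
      ≤ idealTau b ν * (volume (moveMap 0 q R '' idealCell b ν)).toReal * ‖B‖ :=
  cubic_clause_image_moveMap (cubic_clause_idealCell hC hT b hν) (idealTau_nonneg b hν.le) q R B

/-- Unit density: `ρ|moved ideal cell| = 1` for `ρ = √2/ν³`. -/
theorem rho_mul_volume_refCell (hC : HasRadialMoments (rdCell 1) 16 24 (656 / 15)) (b : Bool) {ν : ℝ}
    (hν : 0 < ν) (q : E3) (R : E3 ≃ₗᵢ[ℝ] E3) :
    Real.sqrt 2 / ν ^ 3 * (volume (moveMap 0 q R '' idealCell b ν)).toReal = 1 := by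
  rw [volume_image_moveMap, volume_idealCell hC b hν]
  have hs2 : 0 < Real.sqrt 2 := by positivity
  field_simp

/-! ### ★ The ledger on the ideal templates -/

/-- ★ 27V-L on the ideal templates (r1701 (β)(ii)): the far-field ledger `farField_ledger_unitDensity` with `Kin b =
idealCell b (ν(1−s))`, `Kout b = idealCell b (ν(1+s))`, radius `ν(1+s)/√2`, volume ratio bound `θ`, inner data `σ₁ =
(ν(1−s))²/16`, `δ₁ = 0`, `μ₃ = 3(ν(1−s)/(2√2))³`, `μ₄ = (41/960)(ν(1−s))⁴`, cubic constants `idealTau`, reference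
cells the moved ideal cells at unit density `ρ = √2/ν³`, the nominal second moment of the point values being the
reference lattice's `σ = ν²/16`; all of `ν, s, θ, a, ε` symbolic. -/
theorem farField_ledger_ideal (hC : HasRadialMoments (rdCell 1) 16 24 (656 / 15))
    (hT : |∫ x in trdCell 1, x 0 * x 1 * x 2| ≤ 112 / 405)
    {ι κ : Type*} (t : Finset ι) (u : Finset κ)
    {K : ι → Set E3} {y : ι → E3} {ℓ : ι → Bool} {A : ι → (E3 ≃L[ℝ] E3)} {R : ι → (E3 ≃ₗᵢ[ℝ] E3)}
    {ν s θ a ε : ℝ} {q : κ → E3} {ℓr : κ → Bool} {Rr : κ → (E3 ≃ₗᵢ[ℝ] E3)} {E₃ E₄ : κ → ℝ}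
    {W Uc₁ Uc₂ U : Set E3} {g : E3 → ℝ} {D₁ D₂ D₃ D₄ : ι → ℝ}
    (hν : 0 < ν) (hs0 : 0 ≤ s) (hs1 : s < 1) (hθ0 : 0 ≤ θ) (hθ : (1 + s) ^ 3 ≤ (1 + θ) * (1 - s) ^ 3)
    -- actual movers
    (hε : ∀ i ∈ t, ‖(A i : E3 →L[ℝ] E3) - (R i).toLinearIsometry.toContinuousLinearMap‖ ≤ ε)
    (ha : ∀ i ∈ t, ‖(A i : E3 →L[ℝ] E3)‖ ≤ a)
    (hK : ∀ i ∈ t, IsCompact (K i)) (hKs : ∀ i ∈ t, StarConvex ℝ (y i) (K i))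
    (hvol : ∀ i ∈ t, 0 < (volume (K i)).toReal)
    (hIK : ∀ i ∈ t, affMap 0 (y i) (A i) '' idealCell (ℓ i) (ν * (1 - s)) ⊆ K i)
    (hKO : ∀ i ∈ t, K i ⊆ affMap 0 (y i) (A i) '' idealCell (ℓ i) (ν * (1 + s)))
    (hd : (↑t : Set ι).Pairwise fun i i' => AEDisjoint volume (K i) (K i'))
    -- reference cells
    (hdr : (↑u : Set κ).Pairwise fun j j' =>
      AEDisjoint volume (moveMap 0 (q j) (Rr j) '' idealCell (ℓr j) ν)
        (moveMap 0 (q j') (Rr j') '' idealCell (ℓr j') ν))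
    -- the two tessellations of the window
    (hd₁ : AEDisjoint volume (⋃ i ∈ t, K i) Uc₁) (hc₁ : NullMeasurableSet Uc₁ volume)
    (hcov₁ : ((⋃ i ∈ t, K i) ∪ Uc₁ : Set E3) =ᵐ[volume] W) (hci₁ : IntegrableOn g Uc₁)
    (hd₂ : AEDisjoint volume (⋃ j ∈ u, moveMap 0 (q j) (Rr j) '' idealCell (ℓr j) ν) Uc₂)
    (hc₂ : NullMeasurableSet Uc₂ volume)
    (hcov₂ : ((⋃ j ∈ u, moveMap 0 (q j) (Rr j) '' idealCell (ℓr j) ν) ∪ Uc₂ : Set E3) =ᵐ[volume] W)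
    (hci₂ : IntegrableOn g Uc₂)
    -- the kernel
    (hU : IsOpen U) (hKU : ∀ i ∈ t, K i ⊆ U) (hKrU : ∀ j ∈ u, moveMap 0 (q j) (Rr j) '' idealCell (ℓr j) ν ⊆ U)
    (hg : ContDiffOn ℝ 4 g U)
    (h1 : ∀ i ∈ t, ‖fderiv ℝ g (y i)‖ ≤ D₁ i) (h2 : ∀ i ∈ t, ‖iteratedFDeriv ℝ 2 g (y i)‖ ≤ D₂ i)
    (h3 : ∀ i ∈ t, ‖iteratedFDeriv ℝ 3 g (y i)‖ ≤ D₃ i)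
    (h4 : ∀ i ∈ t, ∀ x ∈ K i, ‖iteratedFDeriv ℝ 4 g x‖ ≤ D₄ i)
    (e3 : ∀ j ∈ u, ‖iteratedFDeriv ℝ 3 g (q j)‖ ≤ E₃ j)
    (e4 : ∀ j ∈ u, ∀ x ∈ moveMap 0 (q j) (Rr j) '' idealCell (ℓr j) ν, ‖iteratedFDeriv ℝ 4 g x‖ ≤ E₄ j) :
    |(∑ i ∈ t, (g (y i) + ν ^ 2 / 16 / 2 * lap g (y i))) - (∑ j ∈ u, (g (q j) + ν ^ 2 / 16 / 2 * lap g (q j)))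
        - (∑ i ∈ t, ((volume (K i)).toReal⁻¹ - Real.sqrt 2 / ν ^ 3) * ∫ x in K i, g x)
        - Real.sqrt 2 / ν ^ 3 * ((∫ x in Uc₂, g x) - ∫ x in Uc₁, g x)|
      ≤ (∑ i ∈ t, (a * (ν * (1 + s) / Real.sqrt 2) * θ * D₁ i
          + (3 * |(ν * (1 - s)) ^ 2 / 16| * ε * (1 + a) + 3 * |(ν * (1 - s)) ^ 2 / 16| * θ
              + 3 * |(ν * (1 - s)) ^ 2 / 16 - ν ^ 2 / 16| + (a * (ν * (1 + s) / Real.sqrt 2)) ^ 2 * θ) / 2 * D₂ i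
          + (idealTau (ℓ i) (ν * (1 - s)) * a ^ 3 + (a * (ν * (1 + s) / Real.sqrt 2)) ^ 3 * θ) / 6 * D₃ i
          + (41 / 960 * (ν * (1 - s)) ^ 4 * a ^ 4 + (a * (ν * (1 + s) / Real.sqrt 2)) ^ 4 * θ) / 24 * D₄ i))
        + ∑ j ∈ u, (idealTau (ℓr j) ν / 6 * E₃ j + 41 / 960 * ν ^ 4 / 24 * E₄ j) := by
  have hνm : 0 < ν * (1 - s) := by nlinarith
  have hνp : 0 < ν * (1 + s) := by nlinarith
  have h := farField_ledger_unitDensity t u (ρ := Real.sqrt 2 / ν ^ 3)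
    (Kin := fun b => idealCell b (ν * (1 - s))) (Kout := fun b => idealCell b (ν * (1 + s)))
    (τ := fun b => idealTau b (ν * (1 - s)))
    (Kr := fun j => moveMap 0 (q j) (Rr j) '' idealCell (ℓr j) ν)
    (δr := fun _ => 0) (μ₃r := fun _ => 3 * (ν / (2 * Real.sqrt 2)) ^ 3) (μ₄r := fun _ => 41 / 960 * ν ^ 4)
    (τr := fun j => idealTau (ℓr j) ν) (E₂ := fun j => ‖iteratedFDeriv ℝ 2 g (q j)‖)
    (fun b => isMomentCell_idealCell hC b hνm) (by positivity) (by positivity)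
    (fun b => idealTau_nonneg b hνm.le) (fun b B => cubic_clause_idealCell hC hT b hνm B)
    (fun b => isCompact_idealCell b hνp.le)
    (fun b => idealCell_mono b (by nlinarith))
    (fun b => idealCell_subset_closedBall b hνp.le) hθ0
    (fun b => volume_idealCell_ratio_le hC b hν hs0 hs1 hθ)
    hε ha hK hKs hvol hIK hKO hd
    (fun j hj => isLooseMomentCell_refCell hC (ℓr j) hν (q j) (Rr j)) hdr
    (fun j hj => idealTau_nonneg (ℓr j) hν.le)
    (fun j hj B => cubic_clause_refCell hC hT (ℓr j) hν (q j) (Rr j) B)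
    (by positivity) (fun j hj => rho_mul_volume_refCell hC (ℓr j) hν (q j) (Rr j))
    hd₁ hc₁ hcov₁ hci₁ hd₂ hc₂ hcov₂ hci₂ hU hKU hKrU hg h1 h2 h3 h4 (fun j hj => le_rfl) e3 e4
  simpa only [zero_div, zero_mul, zero_add] using h

end

end Summit.AtomisticToContinuum.Crystallization.Theorems.OverbindingBudgetAffineFarFieldCellLedgerIdeal
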